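import Summits.NavierStokesRegularity.NavierStokesRegularity.Theorems.SqueezeCycleSingularZoomData
import HarnessLib

/-!
# Route `ScaledTopAlignment`, crux GAP″ = `TypeIZoomNonAlignedLimit` (stmt-NavierStokesRegularity-19902):
# the Oseen integral equation of a classical Leray–Hopf solution bounded on closed sub-strips, and of
# its Type-I zooms about moving centres

Support file (theorems only) for the zoom step (p3's `stub_zoomProfile` / `stub_zoomSlices`) of the
crux `TypeIZoomNonAlignedLimit`. The crux is stated for classical Leray–Hopf solutions on `[0, T)`
with SLAB `L^∞` BOUNDS (`∀ T' < T, ∃ M, |u| ≤ M on [0, T'] × ℝ³`) and no decay hypothesis on the datum.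
The tree's zoom data file `SqueezeCycleSingularZoomData` (item `SingularZoom`, stmt-10573) proves the
Oseen integral equation `u(t) = e^{ν(t−s)Δ}u(s) − B^ν_s(u,u)(t)` between positive times
(`oseen_eq_of_classical`) and its transport to the viscosity-normalising zooms (`zoom_oseen`) for
solutions from a RAPIDLY DECAYING datum, the decay entering only through the slab bounds
(`exists_forall_norm_le_of_tao2011`). This file re-threads the same three proofs with the slab bounds
taken as a hypothesis:

* `oseen_eq_of_classical_of_slab` — Lemarié-Rieusset 2016, Thm. 6.1 / Fabes–Jones–Rivière 1972 (the
  tree's `ae_eq_heatExtension_sub_oseenDuhamel_of_isMildNSSolutionOn` for the bounded finite-energy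
  duality-mild field, restarted at `s` by `oseenMild_restart_holds`, a.e. upgraded to everywhere by
  continuity);
* `oseen_eq_timeRescale_of_classical_of_slab` — the same at unit viscosity for `ũ(s, x) = ν⁻¹u(s/ν, x)`;
* `zoom_oseen_of_slab` — the Oseen equation of the zooms `(cα) • u ∘ Φ`, `Φ(s, y) = (T + c²β s, x₀ + cR y)`
  (`α = R/ν`, `β = R²/ν`) on their final windows `(−δ/(c²β), 0)` (KNSS 2009, §1 (1.2)).

## References

* P. G. Lemarié-Rieusset, *The Navier–Stokes Problem in the 21st Century*, CRC 2016, Thm. 6.1,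
  Prop. 6.5. [LemarieRieusset2016]
* G. Koch, N. Nadirashvili, G. Seregin, V. Šverák, Acta Math. 203 (2009) 83–105, §1 (1.1)–(1.2), §4
  p. 8 (arXiv:0709.3599). [KochNadirashviliSereginSverak2009]
-/

noncomputable section

-- the summit and its single sub-problem share the name (CONVENTIONS §1), as in every Theorems file
set_option linter.dupNamespace false

open MeasureTheory Set Function Filter TopologicalSpace Metric
open scoped Topology NNReal ENNReal InnerProductSpace RealInnerProductSpace

namespace Summit.NavierStokesRegularity.NavierStokesRegularity.Theorems

open Literature.Analysis Literature.Analysis.FluidPDE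

section Oseen

variable {ν T : ℝ} {u : ℝ → EuclideanSpace ℝ (Fin 3) → EuclideanSpace ℝ (Fin 3)}
  {p : ℝ → EuclideanSpace ℝ (Fin 3) → ℝ}

/-- **The Oseen integral equation of a classical Leray–Hopf solution bounded on closed sub-strips,
between positive times**: for `ν > 0`, `0 < T`, a classical solution on `ℝ³ × [0, T)`, Leray–Hopf
from `u 0`, bounded on every `[0, T₁] × ℝ³`, `T₁ < T`, and `0 < s < t < T`:
`u(t) = e^{ν(t−s)Δ}u(s) − B^ν_s(u, u)(t)` pointwise (the proof of the tree's `oseen_eq_of_classical`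
with the slab bounds as a hypothesis in place of the rapid decay of the datum;
Lemarié-Rieusset 2016, Thm. 6.1 with Prop. 6.5; KNSS 2009, §4 p. 8 for the restart). [cite: LemarieRieusset2016, Thm. 6.1 with Prop. 6.5 (pp. 133–136)] -/
theorem oseen_eq_of_classical_of_slab (hν : 0 < ν) (hT : 0 < T)
    (hsol : IsClassicalNSSolutionOn (Ico 0 T) ν 0 u p) (hLH : IsLerayHopfOn T ν 0 (u 0) u)
    (hbdd : ∀ T₁ ∈ Ioo 0 T, ∃ M : ℝ, ∀ t ∈ Icc 0 T₁, ∀ x, ‖u t x‖ ≤ M)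
    {s t : ℝ} (hs : 0 < s) (hst : s < t) (htT : t < T)
    (x : EuclideanSpace ℝ (Fin 3)) :
    u t x = UnboundedOperators.heatExtension (u s) (ν * (t - s)) x - oseenDuhamel ν s u u t x := by
  -- adapted from `oseen_eq_of_classical` (`SqueezeCycleSingularZoomData`), slab bounds as hypothesis
  have hcont : ContinuousOn (uncurry u) (Ico 0 T ×ˢ univ) := hsol.smooth_velocity.continuousOn
  have hmeasT : AEStronglyMeasurable (uncurry u) (volume.restrict (Ioo 0 T ×ˢ univ)) :=
    (hcont.mono (prod_mono Ioo_subset_Ico_self Subset.rfl)).aestronglyMeasurable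
      (measurableSet_Ioo.prod MeasurableSet.univ)
  have hslc : ∀ τ ∈ Ico 0 T, Continuous (u τ) := fun τ hτ =>
    (hsol.contDiff_velocity hτ).continuous
  have hsl : ∀ τ ∈ Ico 0 T, AEStronglyMeasurable (u τ) volume := fun τ hτ =>
    (hslc τ hτ).aestronglyMeasurable
  have hdiv0 : IsWeaklyDivFree (u 0) := hLH.isWeaklyDivFree_datum hT
  have hu02 : MemLp (u 0) 2 volume := hLH.memLp 0 ⟨le_rfl, hT.le⟩
  have hmildT : IsMildNSSolutionOn (Ioc 0 T) ν 0 (u 0) u :=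
    isMildNSSolutionOn_of_isLerayHopfOn_holds hν hT hu02 hLH
  -- the representation from time `0`, a.e., at every `t ∈ (0, T)`
  have hrepr : ∀ τ ∈ Ioo 0 T, u τ =ᵐ[volume] fun y =>
      UnboundedOperators.heatExtension (u 0) (ν * τ) y - oseenDuhamel ν 0 u u τ y := by
    intro τ hτ
    set T' : ℝ := (τ + T) / 2 with hT'
    have hT'0 : 0 < T' := by rw [hT']; linarith [hτ.1]
    have hτT' : τ < T' := by rw [hT']; linarith [hτ.2]
    have hT'T : T' < T := by rw [hT']; linarith [hτ.2]
    obtain ⟨M, hM⟩ := hbdd T' ⟨hT'0, hT'T⟩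
    have hM' : ∀ σ ∈ Icc 0 T', ∀ y, ‖u σ y‖ ≤ max M 1 := fun σ hσ y =>
      (hM σ hσ y).trans (le_max_left _ _)
    exact ae_eq_heatExtension_sub_oseenDuhamel_of_isMildNSSolutionOn hν hT'0
      (hmildT.mono (Ioc_subset_Ioc_right hT'T.le))
      (hmeasT.mono_measure (Measure.restrict_mono (prod_mono (Ioo_subset_Ioo_right hT'T.le)
        Subset.rfl) le_rfl))
      (fun σ hσ => hsl σ ⟨hσ.1, hσ.2.trans_lt hT'T⟩) (lt_of_lt_of_le one_pos (le_max_right _ _))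
      hM' hdiv0 (fun σ hσ => hLH.memLp σ ⟨hσ.1, hσ.2.trans hT'T.le⟩) ⟨hτ.1, hτT'.le⟩
  -- uniform essential bounds on sub-strips
  have hbounds : ∀ T₁ ∈ Ioo 0 T, ∃ C : ℝ≥0∞, C < ∞ ∧ ∀ τ ∈ Ico 0 T₁, eLpNorm (u τ) ∞ volume ≤ C := by
    intro T₁ hT₁
    obtain ⟨M, hM⟩ := hbdd T₁ hT₁
    refine ⟨ENNReal.ofReal M, ENNReal.ofReal_lt_top, fun τ hτ => ?_⟩
    rw [eLpNorm_exponent_top]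
    exact eLpNormEssSup_le_of_ae_bound (Eventually.of_forall fun y => hM τ ⟨hτ.1, hτ.2.le⟩ y)
  -- restart at `s`, a.e.
  have hae : u t =ᵐ[volume] fun y =>
      UnboundedOperators.heatExtension (u s) (ν * (t - s)) y - oseenDuhamel ν s u u t y :=
    oseenMild_restart_holds (EuclideanSpace ℝ (Fin 3)) hν hT hmeasT (hsl 0 ⟨le_rfl, hT⟩) hbounds
      hrepr hs hst htT
  -- both sides are continuous in `x`
  obtain ⟨M, hM⟩ := hbdd ((t + T) / 2) ⟨by linarith, by linarith⟩
  have hM0 : 0 ≤ M := (norm_nonneg _).trans (hM 0 ⟨le_rfl, by linarith⟩ 0)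
  have hsI : s ∈ Ico 0 T := ⟨hs.le, hst.trans htT⟩
  have hheat : Continuous fun y => UnboundedOperators.heatExtension (u s) (ν * (t - s)) y :=
    (UnboundedOperators.contDiff_heatExtension_of_bound (m := 0) (hslc s hsI)
      (fun z => hM s ⟨hs.le, by linarith⟩ z) (mul_pos hν (sub_pos.2 hst))).continuous
  have hmeas_st : AEStronglyMeasurable (uncurry u)
      ((volume : Measure (ℝ × EuclideanSpace ℝ (Fin 3))).restrict (Ioo s t ×ˢ univ)) :=
    hmeasT.mono_measure (Measure.restrict_mono
      (prod_mono (Ioo_subset_Ioo hs.le htT.le) Subset.rfl) le_rfl)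
  have hbd_st : ∀ τ ∈ Ioo s t, ∀ y, ‖u τ y‖ ≤ M := fun τ hτ y =>
    hM τ ⟨(hs.trans hτ.1).le, by linarith [hτ.2]⟩ y
  have hduh : Continuous (oseenDuhamel ν s u u t) :=
    continuous_oseenDuhamel_slice hν hM0 hmeas_st hmeas_st hbd_st hbd_st hst le_rfl
  have heq := (Continuous.ae_eq_iff_eq volume (hslc t ⟨hs.le.trans hst.le, htT⟩)
    (hheat.sub hduh)).1 hae
  exact congrFun heq x

/-- **The Oseen equation at unit viscosity for the normalised field** `ũ = timeRescale ν⁻¹ ν⁻¹ u`,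
`ũ(s, x) = ν⁻¹u(s/ν, x)`, of a classical Leray–Hopf solution bounded on closed sub-strips: for
`0 < σ < τ < νT`, `ũ(τ) = e^{(τ−σ)Δ}ũ(σ) − B¹_σ(ũ, ũ)(τ)` pointwise (KNSS 2009, §1 (1.1): `ν = 1`
by rescaling). [cite: KochNadirashviliSereginSverak2009, §1 (1.1) (arXiv p. 2)] -/
theorem oseen_eq_timeRescale_of_classical_of_slab (hν : 0 < ν) (hT : 0 < T)
    (hsol : IsClassicalNSSolutionOn (Ico 0 T) ν 0 u p) (hLH : IsLerayHopfOn T ν 0 (u 0) u)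
    (hbdd : ∀ T₁ ∈ Ioo 0 T, ∃ M : ℝ, ∀ t ∈ Icc 0 T₁, ∀ x, ‖u t x‖ ≤ M)
    {σ τ : ℝ} (hσ : 0 < σ) (hστ : σ < τ) (hτ : τ < ν * T)
    (x : EuclideanSpace ℝ (Fin 3)) :
    timeRescale ν⁻¹ ν⁻¹ u τ x =
      UnboundedOperators.heatExtension (timeRescale ν⁻¹ ν⁻¹ u σ) (τ - σ) x -
        oseenDuhamel 1 σ (timeRescale ν⁻¹ ν⁻¹ u) (timeRescale ν⁻¹ ν⁻¹ u) τ x := by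
  -- adapted from `oseen_eq_timeRescale_of_classical` (`SqueezeCycleSingularZoomData`)
  have hν0 : ν ≠ 0 := hν.ne'
  obtain ⟨s, rfl⟩ : ∃ s, σ = ν * s := ⟨ν⁻¹ * σ, by field_simp⟩
  obtain ⟨t, rfl⟩ : ∃ t, τ = ν * t := ⟨ν⁻¹ * τ, by field_simp⟩
  have hs : 0 < s := by
    rcases lt_or_ge 0 s with h | h
    · exact h
    · nlinarith
  have hst : s < t := lt_of_mul_lt_mul_left hστ hν.le
  have htT : t < T := lt_of_mul_lt_mul_left hτ hν.le
  rw [oseenDuhamel_one_timeRescale hν u hst.le x, timeRescale_apply, timeRescale_slice,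
    UnboundedOperators.heatExtension_const_smul, show ν⁻¹ * (ν * t) = t by field_simp,
    show ν⁻¹ * (ν * s) = s by field_simp, show ν * t - ν * s = ν * (t - s) by ring, ← smul_sub,
    oseen_eq_of_classical_of_slab hν hT hsol hLH hbdd hs hst htT x]

end Oseen

section Zoom

variable {ν T : ℝ} {u : ℝ → EuclideanSpace ℝ (Fin 3) → EuclideanSpace ℝ (Fin 3)}
  {p : ℝ → EuclideanSpace ℝ (Fin 3) → ℝ} {x₀ : EuclideanSpace ℝ (Fin 3)} {C δ R α β c : ℝ}

/-- **The Oseen integral equation of the zooms on their final windows**, for a classical Leray–Hopf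
solution bounded on closed sub-strips (KNSS 2009, §1 (1.2): the rescaled solutions "are mild
solutions … for suitable re-scalings of the initial datum"): with `α = R/ν`, `β = R²/ν`, `0 < c`,
`δ ≤ T`, the zoom `w = (cα) • u ∘ Φ`, `Φ(s, y) = (T + c²β s, x₀ + cR y)`, satisfies
`w(τ) = e^{(τ−σ)Δ}w(σ) − B¹_σ(w, w)(τ)` pointwise for `−δ/(c²β) < σ < τ < 0` (the proof of the tree's
`zoom_oseen` over `oseen_eq_timeRescale_of_classical_of_slab`). [cite: KochNadirashviliSereginSverak2009, §1 (1.2) and proof of Thm 6.2 (arXiv p. 13)] -/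
theorem zoom_oseen_of_slab (hν : 0 < ν) (hT : 0 < T)
    (hsol : IsClassicalNSSolutionOn (Ico 0 T) ν 0 u p) (hLH : IsLerayHopfOn T ν 0 (u 0) u)
    (hbdd : ∀ T₁ ∈ Ioo 0 T, ∃ M : ℝ, ∀ t ∈ Icc 0 T₁, ∀ x, ‖u t x‖ ≤ M)
    (hR : 0 < R) (hα : α = R / ν) (hβ : β = R ^ 2 / ν) (hc : 0 < c) (hδT : δ ≤ T) {σ τ : ℝ}
    (hσ : -(δ / (c ^ 2 * β)) < σ) (hστ : σ < τ) (hτ : τ < 0) (y : EuclideanSpace ℝ (Fin 3)) :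
    ((c * α) • stPull (c ^ 2 * β) (c * R) T x₀ u) τ y =
      UnboundedOperators.heatExtension (((c * α) • stPull (c ^ 2 * β) (c * R) T x₀ u) σ) (τ - σ) y -
        oseenDuhamel 1 σ ((c * α) • stPull (c ^ 2 * β) (c * R) T x₀ u)
          ((c * α) • stPull (c ^ 2 * β) (c * R) T x₀ u) τ y := by
  -- adapted from `zoom_oseen` (`SqueezeCycleSingularZoomData`)
  have hν0 : ν ≠ 0 := hν.ne'
  have hβpos : 0 < β := by rw [hβ]; positivity
  have hcR : 0 < c * R := mul_pos hc hR
  have hcb : (c * R) ^ 2 = ν * (c ^ 2 * β) := by rw [hβ]; field_simp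
  have hσ' : 0 < ν * T + (c * R) ^ 2 * σ := by
    have hσs : σ ∈ Ioo (-(δ / (c ^ 2 * β))) 0 := ⟨hσ, hστ.trans hτ⟩
    obtain ⟨-, hI⟩ := zoom_time_mem (T := T) hc hβpos hδT hσs
    have h1 : 0 ≤ T + c ^ 2 * β * σ := hI.1
    have h2 : -δ < c ^ 2 * β * σ := by
      have hcb' : 0 < c ^ 2 * β := by positivity
      have := mul_lt_mul_of_pos_left hσ hcb'
      rwa [mul_neg, mul_div_cancel₀ _ hcb'.ne'] at this
    rw [hcb, show ν * T + ν * (c ^ 2 * β) * σ = ν * (T + c ^ 2 * β * σ) by ring]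
    refine mul_pos hν (lt_of_le_of_ne h1 fun h => ?_)
    have : c ^ 2 * β * σ = -T := by linarith
    linarith
  have hτ' : ν * T + (c * R) ^ 2 * τ < ν * T := by
    have : (c * R) ^ 2 * τ < 0 := mul_neg_of_pos_of_neg (by positivity) hτ
    linarith
  have hστ' : ν * T + (c * R) ^ 2 * σ < ν * T + (c * R) ^ 2 * τ := by
    have := mul_lt_mul_of_pos_left hστ (show 0 < (c * R) ^ 2 by positivity)
    linarith
  rw [zoom_eq_smul_stPull_timeRescale (T := T) (x₀ := x₀) (u := u) (c := c) hν hα hβ]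
  exact oseen_smul_stPull hcR (ν * T) x₀ hστ (fun X =>
    oseen_eq_timeRescale_of_classical_of_slab hν hT hsol hLH hbdd hσ' hστ' hτ' X) y

end Zoom

end Summit.NavierStokesRegularity.NavierStokesRegularity.Theorems

end
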